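import Literature.Analysis.FluidPDE.NSFourierPicard
import Mathlib.Analysis.Calculus.ParametricIntegral
import Mathlib.MeasureTheory.Integral.IntervalIntegral.FundThmCalculus
import Mathlib.Data.Nat.Choose.Sum
import HarnessLib

/-!
# Time-derivative families on the Fourier side

Fourth file of the Fourier-side construction of Leray's local regular solution
(`Literature.Analysis.FluidPDE.local_regular_solution_exists` in `NSLocalRegular`, the existence half of the named fact
`Literature.Analysis.FluidPDE.local_classical_lerayHopf`). Smoothness of the synthesized
velocity `u(t, x) = 𝓕 v(t)(x)` *jointly* in `(t, x)` on the closed slab `[0, T] × E`, including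
one-sided derivatives at `t = 0`, is obtained (next file, `NSFourierSynthesis`) from the
existence, for every `n`, of a finite family `W₀ = v, W₁ = ∂ₜv, …, W_n = ∂ₜⁿ v` of Fourier-side
coefficient functions, each with measurable time slices, every polynomial frequency decay
uniformly on `[0, T]`, continuous in time, and with `∂ₜ W_k = W_{k+1}` **within `[0, T]`**
pointwise in the frequency. This file sets up that notion, `IsFourierFamily T n W`, and proves
its closure properties:

* shifts, sums, scalar multiples, multiplication by a measurable symbol of polynomial growth
  (space derivatives `-2πi⟪ξ, h⟫`, the heat symbol `‖ξ‖²`, the pressure symbol `ξⱼξₖ/‖ξ‖²`);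
* the **Leibniz family** of the frequency convolution of two families
  (`leibnizFamily F G k = ∑ᵢ C(k,i) F_i ⋆ G_{k-i}`, Mathlib `Finset.sum_choose_succ_mul`), which
  requires differentiating the convolution under the integral sign *within* `[0, T]`;
* hence the projected nonlinearity `N` and the pressure symbol `q` of two families are families.

The analytic input is a **one-sided parametric differentiation lemma**
(`hasDerivWithinAt_integral_Icc`): Mathlib's `hasDerivAt_integral_of_dominated_loc_of_deriv_le`
is two-sided, so a function with derivatives within `[0, T]` is first extended to `ℝ` by its
tangent lines at the endpoints (`icExtend`, a `C¹` extension, `hasDerivAt_icExtend`).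

(Leray 1934, §19 with pp. 220–221: the derivatives of the regular solution exist and are
continuous up to `t = 0`; Ożański–Pooley 2018, Cor. 6.16 and the remark after Def. 6.20. The
Fourier-side bookkeeping is that of the pseudo-measure method, Lemarié-Rieusset 2016, §8.5.)

## Mathlib search

`hasDerivAt_integral_of_dominated_loc_of_deriv_le`, `HasDerivWithinAt.union`,
`HasDerivWithinAt.mono_of_mem_nhdsWithin`, `HasDerivAt.congr_of_eventuallyEq`,
`Finset.sum_choose_succ_mul`, `HasDerivWithinAt.fun_sum`. No Mathlib notion of one-sided
parametric differentiation under the integral sign (searched `hasDerivWithinAt_integral`).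

## References

* J. Leray, Acta Math. 63 (1934), §19, pp. 220–221. [Leray1934]
* W. S. Ożański, B. C. Pooley, LMS LN 452, CUP 2018, Cor. 6.16, Def. 6.20. [OzanskiPooley2018]
* P. G. Lemarié-Rieusset, *The Navier–Stokes problem in the 21st century*, CRC 2016, §8.5.
-/

noncomputable section

open MeasureTheory Real Set Filter Topology Function
open scoped Convolution ComplexConjugate

namespace Literature.Analysis.FluidPDE.FourierNS

/-! ### `C¹` extension off `[0, T]` and one-sided differentiation under the integral sign -/

section Extend

variable {V : Type*} [NormedAddCommGroup V] [NormedSpace ℝ V]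

/-- Extension of `f : [0, T] → V` to `ℝ` by the tangent lines at the endpoints:
`f (clamp t) + (t - clamp t) • f' (clamp t)`; it is `C¹` when `f' ` is the derivative of `f`
within `[0, T]`. [folklore] -/
def icExtend (T : ℝ) (f f' : ℝ → V) (t : ℝ) : V :=
  f (clamp T t) + (t - clamp T t) • f' (clamp T t)

variable {T t : ℝ} {f f' : ℝ → V}

/-- On `[0, T]` the extension is `f`. [folklore] -/
theorem icExtend_of_mem (ht : t ∈ Icc 0 T) : icExtend T f f' t = f t := by
  simp [icExtend, clamp_of_mem ht]

/-- Left of `0` the extension is the tangent line at `0`. [folklore] -/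
theorem icExtend_of_nonpos (hT : 0 ≤ T) (ht : t ≤ 0) : icExtend T f f' t = f 0 + t • f' 0 := by
  have : clamp T t = 0 := by
    simp [clamp, min_eq_left (ht.trans hT), max_eq_left ht]
  simp [icExtend, this]

/-- Right of `T` the extension is the tangent line at `T`. [folklore] -/
theorem icExtend_of_le (hT : 0 ≤ T) (ht : T ≤ t) : icExtend T f f' t = f T + (t - T) • f' T := by
  have : clamp T t = T := by
    simp [clamp, min_eq_right ht, max_eq_right hT]
  simp [icExtend, this]

/-- **The tangent-line extension is differentiable everywhere**, with derivative
`f' (clamp T t)`, provided `f` has derivative `f'` within `[0, T]` at every point of `[0, T]`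
and `T > 0` (gluing of one-sided derivatives at `0` and `T`). [folklore] -/
theorem hasDerivAt_icExtend (hT : 0 < T)
    (hf : ∀ t ∈ Icc 0 T, HasDerivWithinAt f (f' t) (Icc 0 T) t) (t : ℝ) :
    HasDerivAt (icExtend T f f') (f' (clamp T t)) t := by
  -- the two tangent lines
  have hL : ∀ s, HasDerivAt (fun s : ℝ => f 0 + s • f' 0) (f' 0) s := fun s => by
    simpa using ((hasDerivAt_id s).smul_const (f' 0)).const_add (f 0)
  have hR : ∀ s, HasDerivAt (fun s : ℝ => f T + (s - T) • f' T) (f' T) s := fun s => by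
    simpa using (((hasDerivAt_id s).sub_const T).smul_const (f' T)).const_add (f T)
  rcases lt_trichotomy t 0 with ht | rfl | ht
  · -- `t < 0`
    have hcl : clamp T t = 0 := by simp [clamp, min_eq_left (ht.le.trans hT.le), max_eq_left ht.le]
    rw [hcl]
    refine (hL t).congr_of_eventuallyEq ?_
    filter_upwards [Iio_mem_nhds ht] with s hs
    exact icExtend_of_nonpos hT.le (le_of_lt hs)
  · -- `t = 0`: glue
    rw [clamp_zero hT.le]
    have hl : HasDerivWithinAt (icExtend T f f') (f' 0) (Iic 0) 0 :=
      (hL 0).hasDerivWithinAt.congr (fun s hs => icExtend_of_nonpos hT.le hs)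
        (icExtend_of_nonpos hT.le le_rfl)
    have hr0 : HasDerivWithinAt (icExtend T f f') (f' 0) (Icc 0 T) 0 :=
      (hf 0 ⟨le_rfl, hT.le⟩).congr (fun s hs => icExtend_of_mem hs)
        (icExtend_of_mem ⟨le_rfl, hT.le⟩)
    have hmem : Icc 0 T ∈ 𝓝[Ici 0] (0 : ℝ) := by
      rw [← Ici_inter_Iic]
      exact Filter.inter_mem self_mem_nhdsWithin (mem_nhdsWithin_of_mem_nhds (Iic_mem_nhds hT))
    have hr : HasDerivWithinAt (icExtend T f f') (f' 0) (Ici 0) 0 := hr0.mono_of_mem_nhdsWithin hmem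
    have := hl.union hr
    rwa [Iic_union_Ici, hasDerivWithinAt_univ] at this
  · rcases lt_trichotomy t T with htT | rfl | htT
    · -- interior point
      have hI : t ∈ Icc 0 T := ⟨ht.le, htT.le⟩
      rw [clamp_of_mem hI]
      have h1 : HasDerivAt f (f' t) t := (hf t hI).hasDerivAt (Icc_mem_nhds ht htT)
      refine h1.congr_of_eventuallyEq ?_
      filter_upwards [Icc_mem_nhds ht htT] with s hs
      exact icExtend_of_mem hs
    · -- `t = T`: glue
      have hI : t ∈ Icc 0 t := ⟨ht.le, le_rfl⟩
      rw [clamp_of_mem hI]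
      have hl0 : HasDerivWithinAt (icExtend t f f') (f' t) (Icc 0 t) t :=
        (hf t hI).congr (fun s hs => icExtend_of_mem hs) (icExtend_of_mem hI)
      have hmem : Icc 0 t ∈ 𝓝[Iic t] t := by
        rw [← Ici_inter_Iic]
        exact Filter.inter_mem (mem_nhdsWithin_of_mem_nhds (Ici_mem_nhds ht)) self_mem_nhdsWithin
      have hl : HasDerivWithinAt (icExtend t f f') (f' t) (Iic t) t := hl0.mono_of_mem_nhdsWithin hmem
      have hr : HasDerivWithinAt (icExtend t f f') (f' t) (Ici t) t :=
        (hR t).hasDerivWithinAt.congr (fun s hs => icExtend_of_le hT.le hs)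
          (icExtend_of_le hT.le le_rfl)
      have := hl.union hr
      rwa [Iic_union_Ici, hasDerivWithinAt_univ] at this
    · -- `t > T`
      have hcl : clamp T t = T := by simp [clamp, min_eq_right htT.le, max_eq_right hT.le]
      rw [hcl]
      refine (hR t).congr_of_eventuallyEq ?_
      filter_upwards [Ioi_mem_nhds htT] with s hs
      exact icExtend_of_le hT.le (le_of_lt hs)

variable {α : Type*} [MeasurableSpace α] {μ : Measure α}

/-- **Differentiation under the integral sign within `[0, T]`.** Let `F t a` have derivative
`F' t a` within `[0, T]` at every `t ∈ [0, T]`, for every `a`; assume the time slices of `F`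
and `F'` are a.e.-strongly measurable, `F t` is integrable for `t ∈ [0, T]`, and
`‖F' t a‖ ≤ bound a` on `[0, T]` with `bound` integrable. Then `t ↦ ∫ F t a dμ` has derivative
`∫ F' t₀ a dμ` within `[0, T]` at every `t₀ ∈ [0, T]` (reduce to Mathlib's two-sided
`hasDerivAt_integral_of_dominated_loc_of_deriv_le` via the tangent-line extension). [folklore] -/
theorem hasDerivWithinAt_integral_Icc [CompleteSpace V] (hT : 0 < T) {F F' : ℝ → α → V}
    {bound : α → ℝ}
    (hF_meas : ∀ t ∈ Icc 0 T, AEStronglyMeasurable (F t) μ)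
    (hF'_meas : ∀ t ∈ Icc 0 T, AEStronglyMeasurable (F' t) μ)
    (hF_int : ∀ t ∈ Icc 0 T, Integrable (F t) μ)
    (h_bound : ∀ t ∈ Icc 0 T, ∀ a, ‖F' t a‖ ≤ bound a) (hbound : Integrable bound μ)
    (h_diff : ∀ a, ∀ t ∈ Icc 0 T, HasDerivWithinAt (F · a) (F' t a) (Icc 0 T) t)
    {t₀ : ℝ} (ht₀ : t₀ ∈ Icc 0 T) :
    HasDerivWithinAt (fun t => ∫ a, F t a ∂μ) (∫ a, F' t₀ a ∂μ) (Icc 0 T) t₀ := by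
  set G : ℝ → α → V := fun t a => icExtend T (F · a) (F' · a) t with hG
  set G' : ℝ → α → V := fun t a => F' (clamp T t) a with hG'
  have hG_eq : ∀ t, G t = fun a => F (clamp T t) a + (t - clamp T t) • F' (clamp T t) a := fun t =>
    rfl
  have hG_meas : ∀ t, AEStronglyMeasurable (G t) μ := fun t => by
    rw [hG_eq]
    exact (hF_meas _ (clamp_mem_Icc hT.le t)).add
      ((hF'_meas _ (clamp_mem_Icc hT.le t)).const_smul _)
  have hG_int : Integrable (G t₀) μ := by
    have : G t₀ = F t₀ := by
      funext a; exact icExtend_of_mem ht₀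
    rw [this]; exact hF_int t₀ ht₀
  have hG'_meas : AEStronglyMeasurable (G' t₀) μ := hF'_meas _ (clamp_mem_Icc hT.le t₀)
  have h_bd : ∀ᵐ a ∂μ, ∀ t ∈ (univ : Set ℝ), ‖G' t a‖ ≤ bound a :=
    Eventually.of_forall fun a t _ => h_bound _ (clamp_mem_Icc hT.le t) a
  have h_df : ∀ᵐ a ∂μ, ∀ t ∈ (univ : Set ℝ), HasDerivAt (G · a) (G' t a) t :=
    Eventually.of_forall fun a t _ => hasDerivAt_icExtend hT (h_diff a) t
  have h := (hasDerivAt_integral_of_dominated_loc_of_deriv_le (μ := μ) (F := G) (x₀ := t₀)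
    (s := univ) univ_mem (Eventually.of_forall hG_meas) hG_int hG'_meas h_bd hbound h_df).2
  have hG't₀ : (fun a => G' t₀ a) = fun a => F' t₀ a := by
    funext a; simp [hG', clamp_of_mem ht₀]
  rw [hG't₀] at h
  refine h.hasDerivWithinAt.congr (fun t ht => ?_) ?_
  · exact integral_congr_ae (Eventually.of_forall fun a =>
      (icExtend_of_mem (f := fun x => F x a) (f' := fun x => F' x a) ht).symm)
  · exact integral_congr_ae (Eventually.of_forall fun a =>
      (icExtend_of_mem (f := fun x => F x a) (f' := fun x => F' x a) ht₀).symm)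

end Extend

/-! ### Auxiliary decay algebra -/

section DecayAux

variable {X F : Type*} [NormedAddCommGroup X] [NormedAddCommGroup F]

/-- Finite sums of decaying functions decay, with the sum of the constants. [folklore] -/
theorem hasDecay_finset_sum {α : Type*} (s : Finset α) {K : ℕ} {C : α → ℝ} {f : α → X → F}
    (h : ∀ a ∈ s, HasDecay K (C a) (f a)) :
    HasDecay K (∑ a ∈ s, C a) (fun ξ => ∑ a ∈ s, f a ξ) := by
  classical
  induction s using Finset.induction_on with
  | empty => intro ξ; simp
  | insert a s ha ih =>
    intro ξ
    change ‖∑ b ∈ insert a s, f b ξ‖ ≤ (∑ b ∈ insert a s, C b) * ((1 + ‖ξ‖) ^ K)⁻¹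
    rw [Finset.sum_insert ha, Finset.sum_insert ha]
    have h1 := h a (Finset.mem_insert_self a s) ξ
    have h2 := ih (fun b hb => h b (Finset.mem_insert_of_mem hb)) ξ
    calc ‖f a ξ + ∑ b ∈ s, f b ξ‖ ≤ ‖f a ξ‖ + ‖∑ b ∈ s, f b ξ‖ := norm_add_le _ _
      _ ≤ C a * ((1 + ‖ξ‖) ^ K)⁻¹ + (∑ b ∈ s, C b) * ((1 + ‖ξ‖) ^ K)⁻¹ := add_le_add h1 h2
      _ = (C a + ∑ b ∈ s, C b) * ((1 + ‖ξ‖) ^ K)⁻¹ := by ring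

/-- Multiplication by a constant. [folklore] -/
theorem HasDecay.const_mul {K : ℕ} {C : ℝ} {f : X → ℂ} (h : HasDecay K C f) (c : ℂ) :
    HasDecay K (‖c‖ * C) (fun ξ => c * f ξ) :=
  h.of_norm_le_mul (norm_nonneg c) fun ξ => by rw [norm_mul]

/-- Multiplication by a symbol of polynomial growth `‖m ξ‖ ≤ M (1 + ‖ξ‖)^d` costs `d` orders
of decay. [folklore] -/
theorem HasDecay.mul_growth {K d : ℕ} {C M : ℝ} {f m : X → ℂ} (h : HasDecay (K + d) C f)
    (hM : 0 ≤ M) (hm : ∀ ξ, ‖m ξ‖ ≤ M * (1 + ‖ξ‖) ^ d) :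
    HasDecay K (M * C) (fun ξ => m ξ * f ξ) := fun ξ => by
  have hpos : 0 < (1 + ‖ξ‖) ^ d := by positivity
  rw [norm_mul]
  calc ‖m ξ‖ * ‖f ξ‖ ≤ M * (1 + ‖ξ‖) ^ d * (C * ((1 + ‖ξ‖) ^ (K + d))⁻¹) :=
        mul_le_mul (hm ξ) (h ξ) (norm_nonneg _) (by positivity)
    _ = M * C * ((1 + ‖ξ‖) ^ K)⁻¹ := by
        rw [pow_add, mul_inv]; field_simp

end DecayAux

/-! ### Fourier-side families of time derivatives -/

section Family

variable {ι : Type*} [Fintype ι]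

/-- `IsFourierFamily T n W`: `W₀, …, W_n : ℝ → E → ℂ` (`E = EuclideanSpace ℝ ι`) have
a.e.-strongly measurable time slices, every polynomial frequency decay uniformly on `[0, T]`,
are continuous in `t ∈ [0, T]` at each frequency, and `∂ₜ W_k = W_{k+1}` within `[0, T]`
(`k < n`) at each frequency — the Fourier-side content of "`∂ₜᵏ u` exists and is smooth in `x`
up to `t = 0`" for `u(t) = 𝓕 W₀(t)` (Leray 1934, pp. 220–221; Ożański–Pooley 2018,
Def. 6.20 and the remark following it). [folklore] -/
structure IsFourierFamily (T : ℝ) (n : ℕ) (W : ℕ → ℝ → EuclideanSpace ℝ ι → ℂ) : Prop where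
  /-- measurable time slices on `[0, T]` -/
  meas : ∀ k ≤ n, ∀ t ∈ Icc 0 T, AEStronglyMeasurable (W k t) volume
  /-- every polynomial decay, uniformly on `[0, T]` -/
  decay : ∀ k ≤ n, ∀ K : ℕ, ∃ C, ∀ t ∈ Icc 0 T, HasDecay K C (W k t)
  /-- continuity in time on `[0, T]` at each frequency -/
  cont : ∀ k ≤ n, ∀ ξ, ContinuousOn (fun t => W k t ξ) (Icc 0 T)
  /-- `∂ₜ W_k = W_{k+1}` within `[0, T]` -/
  deriv : ∀ k < n, ∀ ξ, ∀ t ∈ Icc 0 T, HasDerivWithinAt (fun s => W k s ξ) (W (k + 1) t ξ) (Icc 0 T) t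

variable {T : ℝ} {n : ℕ} {W W' F G : ℕ → ℝ → EuclideanSpace ℝ ι → ℂ}

/-- Restriction to fewer derivatives. [folklore] -/
theorem IsFourierFamily.mono (h : IsFourierFamily T n W) {m : ℕ} (hm : m ≤ n) :
    IsFourierFamily T m W where
  meas k hk := h.meas k (hk.trans hm)
  decay k hk := h.decay k (hk.trans hm)
  cont k hk := h.cont k (hk.trans hm)
  deriv k hk := h.deriv k (lt_of_lt_of_le hk hm)

/-- **Shift**: the family of `∂ₜ W₀ = W₁`. [folklore] -/
theorem IsFourierFamily.shift (h : IsFourierFamily T (n + 1) W) :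
    IsFourierFamily T n (fun k => W (k + 1)) where
  meas k hk := h.meas (k + 1) (by omega)
  decay k hk := h.decay (k + 1) (by omega)
  cont k hk := h.cont (k + 1) (by omega)
  deriv k hk := h.deriv (k + 1) (by omega)

/-- Sums of families. [folklore] -/
theorem IsFourierFamily.add (h : IsFourierFamily T n W) (h' : IsFourierFamily T n W') :
    IsFourierFamily T n (fun k t ξ => W k t ξ + W' k t ξ) where
  meas k hk t ht := (h.meas k hk t ht).add (h'.meas k hk t ht)
  decay k hk K := by
    obtain ⟨C, hC⟩ := h.decay k hk K
    obtain ⟨C', hC'⟩ := h'.decay k hk K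
    exact ⟨C + C', fun t ht => (hC t ht).add (hC' t ht)⟩
  cont k hk ξ := (h.cont k hk ξ).add (h'.cont k hk ξ)
  deriv k hk ξ t ht := (h.deriv k hk ξ t ht).add (h'.deriv k hk ξ t ht)

/-- Negation. [folklore] -/
theorem IsFourierFamily.neg (h : IsFourierFamily T n W) :
    IsFourierFamily T n (fun k t ξ => -W k t ξ) where
  meas k hk t ht := (h.meas k hk t ht).neg
  decay k hk K := by
    obtain ⟨C, hC⟩ := h.decay k hk K
    exact ⟨C, fun t ht => (hC t ht).neg⟩
  cont k hk ξ := (h.cont k hk ξ).neg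
  deriv k hk ξ t ht := (h.deriv k hk ξ t ht).neg

/-- Differences. [folklore] -/
theorem IsFourierFamily.sub (h : IsFourierFamily T n W) (h' : IsFourierFamily T n W') :
    IsFourierFamily T n (fun k t ξ => W k t ξ - W' k t ξ) := by
  simpa [sub_eq_add_neg] using h.add h'.neg

/-- **Multiplication by a time-independent symbol of polynomial growth**
(`-2πi⟪ξ, h⟫` for space derivatives, `-c‖ξ‖²` for the Laplacian, `ξⱼξₖ/‖ξ‖²` for the
pressure). [folklore] -/
theorem IsFourierFamily.symbol (h : IsFourierFamily T n W) {m : EuclideanSpace ℝ ι → ℂ}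
    (hm : AEStronglyMeasurable m volume) {d : ℕ} {M : ℝ} (hM : 0 ≤ M)
    (hgrowth : ∀ ξ, ‖m ξ‖ ≤ M * (1 + ‖ξ‖) ^ d) :
    IsFourierFamily T n (fun k t ξ => m ξ * W k t ξ) where
  meas k hk t ht := hm.mul (h.meas k hk t ht)
  decay k hk K := by
    obtain ⟨C, hC⟩ := h.decay k hk (K + d)
    exact ⟨M * C, fun t ht => (hC t ht).mul_growth hM hgrowth⟩
  cont k hk ξ := continuousOn_const.mul (h.cont k hk ξ)
  deriv k hk ξ t ht := by
    simpa using (h.deriv k hk ξ t ht).const_mul (m ξ)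

/-- Constant multiples. [folklore] -/
theorem IsFourierFamily.const_mul (h : IsFourierFamily T n W) (c : ℂ) :
    IsFourierFamily T n (fun k t ξ => c * W k t ξ) :=
  h.symbol (m := fun _ => c) aestronglyMeasurable_const (d := 0) (norm_nonneg c)
    (fun ξ => by simp)

/-- Finite sums of families. [folklore] -/
theorem IsFourierFamily.finset_sum {β : Type*} (s : Finset β)
    {Wf : β → ℕ → ℝ → EuclideanSpace ℝ ι → ℂ} (h : ∀ b ∈ s, IsFourierFamily T n (Wf b)) :
    IsFourierFamily T n (fun k t ξ => ∑ b ∈ s, Wf b k t ξ) := by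
  classical
  induction s using Finset.induction_on with
  | empty =>
    exact { meas := fun k hk t ht => by simpa using aestronglyMeasurable_const
            decay := fun k hk K => ⟨0, fun t ht ξ => by simp⟩
            cont := fun k hk ξ => by simpa using continuousOn_const
            deriv := fun k hk ξ t ht => by simpa using hasDerivWithinAt_const t (Icc 0 T) (0:ℂ) }
  | insert b s hb ih =>
    have h1 := (h b (Finset.mem_insert_self b s)).add (ih fun b' hb' => h b' (Finset.mem_insert_of_mem hb'))
    simpa [Finset.sum_insert hb] using h1

/-! #### Convolution of two families: the Leibniz family -/

/-- A uniform-in-time decay constant of order `K` for `W k`, `k ≤ n`. [folklore] -/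
theorem IsFourierFamily.decay' (h : IsFourierFamily T n W) (K : ℕ) :
    ∃ C : ℕ → ℝ, ∀ k ≤ n, ∀ t ∈ Icc 0 T, HasDecay K (C k) (W k t) := by
  classical
  have : ∀ k, ∃ C : ℝ, k ≤ n → ∀ t ∈ Icc 0 T, HasDecay K C (W k t) := fun k => by
    by_cases hk : k ≤ n
    · obtain ⟨C, hC⟩ := h.decay k hk K; exact ⟨C, fun _ => hC⟩
    · exact ⟨0, fun h' => absurd h' hk⟩
  choose C hC using this
  exact ⟨C, hC⟩

/-- `card ι < card ι + 1`, the integrable order used internally. [folklore] -/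
theorem card_lt_succ : Fintype.card ι < Fintype.card ι + 1 := Nat.lt_succ_self _

/-- Time slices of a family are integrable on `[0, T]`. [folklore] -/
theorem IsFourierFamily.integrable (h : IsFourierFamily T n W) {k : ℕ} (hk : k ≤ n) {t : ℝ}
    (ht : t ∈ Icc 0 T) : Integrable (W k t) := by
  obtain ⟨C, hC⟩ := h.decay k hk (Fintype.card ι + 1)
  exact (hC t ht).integrable (finrank_lt_of_card_lt card_lt_succ) (h.meas k hk t ht)

/-- **Derivative of the convolution of two families within `[0, T]`**:
`∂ₜ (F_i ⋆ G_j) = F_{i+1} ⋆ G_j + F_i ⋆ G_{j+1}` for `i, j < n`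
(`hasDerivWithinAt_integral_Icc` with the product rule under the integral). [folklore] -/
theorem IsFourierFamily.hasDerivWithinAt_fconv (hT : 0 < T) (hF : IsFourierFamily T n F)
    (hG : IsFourierFamily T n G) {i j : ℕ} (hi : i < n) (hj : j < n) (ξ : EuclideanSpace ℝ ι)
    {t : ℝ} (ht : t ∈ Icc 0 T) :
    HasDerivWithinAt (fun s => fconv (F i s) (G j s) ξ)
      (fconv (F (i + 1) t) (G j t) ξ + fconv (F i t) (G (j + 1) t) ξ) (Icc 0 T) t := by
  set K₀ := Fintype.card ι + 1 with hK₀def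
  have hK₀ : Fintype.card ι < K₀ := card_lt_succ
  -- uniform decay constants of the four functions involved
  obtain ⟨A, hA⟩ := hF.decay i hi.le K₀
  obtain ⟨A₁, hA₁⟩ := hF.decay (i + 1) hi K₀
  obtain ⟨B, hB⟩ := hG.decay j hj.le K₀
  obtain ⟨B₁, hB₁⟩ := hG.decay (j + 1) hj K₀
  have hI := integrable_inv_one_add_norm_pow (E := EuclideanSpace ℝ ι) (finrank_lt_of_card_lt hK₀)
  -- the integrands
  set Φ : ℝ → EuclideanSpace ℝ ι → ℂ := fun s η => F i s η * G j s (ξ - η) with hΦ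
  set Φ' : ℝ → EuclideanSpace ℝ ι → ℂ := fun s η =>
    F (i + 1) s η * G j s (ξ - η) + F i s η * G (j + 1) s (ξ - η) with hΦ'
  have hΦm : ∀ s ∈ Icc 0 T, AEStronglyMeasurable (Φ s) volume := fun s hs =>
    aestronglyMeasurable_fconv_integrand (hF.meas i hi.le s hs) (hG.meas j hj.le s hs) ξ
  have hΦ'm : ∀ s ∈ Icc 0 T, AEStronglyMeasurable (Φ' s) volume := fun s hs =>
    (aestronglyMeasurable_fconv_integrand (hF.meas (i + 1) hi s hs) (hG.meas j hj.le s hs) ξ).add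
      (aestronglyMeasurable_fconv_integrand (hF.meas i hi.le s hs) (hG.meas (j + 1) hj s hs) ξ)
  have hΦint : ∀ s ∈ Icc 0 T, Integrable (Φ s) := fun s hs =>
    (fconv_bound_mixed hK₀ (hA s hs) (hA s hs) (hB s hs) (hB s hs) (hF.meas i hi.le s hs)
      (hG.meas j hj.le s hs) ξ).1
  -- domination of the derivative
  set bound : EuclideanSpace ℝ ι → ℝ := fun η => (A₁ * B + A * B₁) * ((1 + ‖η‖) ^ K₀)⁻¹
  have hbound : Integrable bound := hI.const_mul _
  have h_bd : ∀ s ∈ Icc 0 T, ∀ η, ‖Φ' s η‖ ≤ bound η := by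
    intro s hs η
    have h1 : ‖F (i + 1) s η * G j s (ξ - η)‖ ≤ A₁ * B * ((1 + ‖η‖) ^ K₀)⁻¹ := by
      rw [norm_mul]
      calc ‖F (i + 1) s η‖ * ‖G j s (ξ - η)‖ ≤ A₁ * ((1 + ‖η‖) ^ K₀)⁻¹ * B :=
            mul_le_mul (hA₁ s hs η) ((hB s hs).norm_le _) (norm_nonneg _)
              ((norm_nonneg _).trans (hA₁ s hs η))
        _ = A₁ * B * ((1 + ‖η‖) ^ K₀)⁻¹ := by ring
    have h2 : ‖F i s η * G (j + 1) s (ξ - η)‖ ≤ A * B₁ * ((1 + ‖η‖) ^ K₀)⁻¹ := by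
      rw [norm_mul]
      calc ‖F i s η‖ * ‖G (j + 1) s (ξ - η)‖ ≤ A * ((1 + ‖η‖) ^ K₀)⁻¹ * B₁ :=
            mul_le_mul (hA s hs η) ((hB₁ s hs).norm_le _) (norm_nonneg _)
              ((norm_nonneg _).trans (hA s hs η))
        _ = A * B₁ * ((1 + ‖η‖) ^ K₀)⁻¹ := by ring
    calc ‖Φ' s η‖ ≤ ‖F (i + 1) s η * G j s (ξ - η)‖ + ‖F i s η * G (j + 1) s (ξ - η)‖ :=
          norm_add_le _ _
      _ ≤ A₁ * B * ((1 + ‖η‖) ^ K₀)⁻¹ + A * B₁ * ((1 + ‖η‖) ^ K₀)⁻¹ := add_le_add h1 h2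
      _ = bound η := by simp only [bound]; ring
  -- pointwise product rule within `[0, T]`
  have h_df : ∀ η, ∀ s ∈ Icc 0 T, HasDerivWithinAt (Φ · η) (Φ' s η) (Icc 0 T) s := by
    intro η s hs
    have h1 := hF.deriv i hi η s hs
    have h2 := hG.deriv j hj (ξ - η) s hs
    have h3 := h1.mul h2
    simp only [hΦ, hΦ']
    exact h3
  have h := hasDerivWithinAt_integral_Icc (μ := (volume : Measure (EuclideanSpace ℝ ι))) hT hΦm
    hΦ'm hΦint h_bd hbound h_df ht
  -- identify the integrals
  have hint1 : Integrable fun η => F (i + 1) t η * G j t (ξ - η) :=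
    (fconv_bound_mixed hK₀ (hA₁ t ht) (hA₁ t ht) (hB t ht) (hB t ht) (hF.meas (i + 1) hi t ht)
      (hG.meas j hj.le t ht) ξ).1
  have hint2 : Integrable fun η => F i t η * G (j + 1) t (ξ - η) :=
    (fconv_bound_mixed hK₀ (hA t ht) (hA t ht) (hB₁ t ht) (hB₁ t ht) (hF.meas i hi.le t ht)
      (hG.meas (j + 1) hj t ht) ξ).1
  have heq : (∫ η, Φ' t η) = fconv (F (i + 1) t) (G j t) ξ + fconv (F i t) (G (j + 1) t) ξ := by
    rw [fconv_apply, fconv_apply, ← integral_add hint1 hint2]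
  rw [heq] at h
  refine h.congr (fun s _ => (fconv_apply _ _ _)) (fconv_apply _ _ _)

/-- Continuity in time of the convolution of two families on `[0, T]`. [folklore] -/
theorem IsFourierFamily.continuousOn_fconv (hF : IsFourierFamily T n F) (hG : IsFourierFamily T n G)
    {i j : ℕ} (hi : i ≤ n) (hj : j ≤ n) (ξ : EuclideanSpace ℝ ι) :
    ContinuousOn (fun s => fconv (F i s) (G j s) ξ) (Icc 0 T) := by
  set K₀ := Fintype.card ι + 1
  have hK₀ : Fintype.card ι < K₀ := card_lt_succ
  obtain ⟨A, hA⟩ := hF.decay i hi K₀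
  obtain ⟨B, hB⟩ := hG.decay j hj K₀
  rw [continuousOn_iff_continuous_restrict]
  have hFc : ∀ η, Continuous fun s : Icc 0 T => F i s η := fun η =>
    continuousOn_iff_continuous_restrict.1 (hF.cont i hi η)
  have hGc : ∀ η, Continuous fun s : Icc 0 T => G j s (ξ - η) := fun η =>
    continuousOn_iff_continuous_restrict.1 (hG.cont j hj (ξ - η))
  exact continuous_fconv_param (X := Icc 0 T) hK₀ (F := fun s => F i s) (G := fun s => G j s)
    (ζ := fun _ => ξ) (fun s => hF.meas i hi s s.2) (fun s => hG.meas j hj s s.2) (fun s => hA s s.2)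
    (fun s => hB s s.2) hFc hGc

/-- **The Leibniz family** of the convolution of two families:
`L_k(t) = ∑_{i ≤ k} C(k, i) F_i(t) ⋆ G_{k-i}(t)` (the candidate for `∂ₜᵏ (F₀ ⋆ G₀)`). [folklore] -/
def leibnizFamily (F G : ℕ → ℝ → EuclideanSpace ℝ ι → ℂ) : ℕ → ℝ → EuclideanSpace ℝ ι → ℂ :=
  fun k t ξ => ∑ i ∈ Finset.range (k + 1), (k.choose i : ℂ) * fconv (F i t) (G (k - i) t) ξ

/-- `L₀ = F₀ ⋆ G₀`. [folklore] -/
@[simp]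
theorem leibnizFamily_zero (F G : ℕ → ℝ → EuclideanSpace ℝ ι → ℂ) (t : ℝ) (ξ : EuclideanSpace ℝ ι) :
    leibnizFamily F G 0 t ξ = fconv (F 0 t) (G 0 t) ξ := by
  simp [leibnizFamily]

/-- **Leibniz rule**: the Leibniz family of two families is a family
(`∂ₜ L_k = L_{k+1}` by `Finset.sum_choose_succ_mul`). [folklore] -/
theorem IsFourierFamily.leibniz (hT : 0 < T) (hF : IsFourierFamily T n F) (hG : IsFourierFamily T n G) :
    IsFourierFamily T n (leibnizFamily F G) := by
  set K₀ := Fintype.card ι + 1 with hK₀def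
  have hK₀ : Fintype.card ι < K₀ := card_lt_succ
  -- each term is a product `C(k,i) * (F_i ⋆ G_{k-i})`; we verify the four clauses termwise
  refine ⟨fun k hk t ht => ?_, fun k hk K => ?_, fun k hk ξ => ?_, fun k hk ξ t ht => ?_⟩
  · -- measurability
    change AEStronglyMeasurable (fun ξ => ∑ i ∈ Finset.range (k + 1),
      (k.choose i : ℂ) * fconv (F i t) (G (k - i) t) ξ) volume
    refine Finset.aestronglyMeasurable_fun_sum _ fun i hi => ?_
    have hi' : i ≤ n := (Nat.lt_succ_iff.1 (Finset.mem_range.1 hi)).trans hk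
    exact aestronglyMeasurable_const.mul
      (aestronglyMeasurable_fconv (hF.integrable hi' ht) (hG.integrable (by omega) ht))
  · -- decay of order `K`
    obtain ⟨A₀, hA₀⟩ := hF.decay' K₀
    obtain ⟨A, hA⟩ := hF.decay' K
    obtain ⟨B₀, hB₀⟩ := hG.decay' K₀
    obtain ⟨B, hB⟩ := hG.decay' K
    refine ⟨∑ i ∈ Finset.range (k + 1), ‖(k.choose i : ℂ)‖ *
      (2 ^ K * weightMass (EuclideanSpace ℝ ι) K₀ * (A i * B₀ (k - i) + A₀ i * B (k - i))),
      fun t ht => ?_⟩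
    refine hasDecay_finset_sum _ fun i hi => ?_
    have hi' : i ≤ n := (Nat.lt_succ_iff.1 (Finset.mem_range.1 hi)).trans hk
    have hki : k - i ≤ n := by omega
    exact (hasDecay_fconv_mixed hK₀ (hA₀ i hi' t ht) (hA i hi' t ht) (hB₀ (k - i) hki t ht)
      (hB (k - i) hki t ht) (hF.meas i hi' t ht) (hG.meas (k - i) hki t ht)).const_mul _
  · -- continuity in time
    change ContinuousOn (fun t => ∑ i ∈ Finset.range (k + 1),
      (k.choose i : ℂ) * fconv (F i t) (G (k - i) t) ξ) (Icc 0 T)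
    refine continuousOn_finsetSum _ fun i hi => ?_
    have hi' : i ≤ n := (Nat.lt_succ_iff.1 (Finset.mem_range.1 hi)).trans hk
    exact continuousOn_const.mul (hF.continuousOn_fconv hG hi' (by omega) ξ)
  · -- the derivative: Leibniz
    have hderiv : HasDerivWithinAt (fun s => leibnizFamily F G k s ξ)
        (∑ i ∈ Finset.range (k + 1), (k.choose i : ℂ) *
          (fconv (F (i + 1) t) (G (k - i) t) ξ + fconv (F i t) (G (k - i + 1) t) ξ)) (Icc 0 T) t := by
      refine HasDerivWithinAt.fun_sum fun i hi => ?_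
      have hi' : i ≤ k := Nat.lt_succ_iff.1 (Finset.mem_range.1 hi)
      exact (hF.hasDerivWithinAt_fconv hT hG (by omega) (by omega) ξ ht).const_mul _
    convert hderiv using 1
    -- `L_{k+1}(t) = ∑ C(k,i) (F_{i+1} ⋆ G_{k-i} + F_i ⋆ G_{k+1-i})`
    change ∑ i ∈ Finset.range (k + 1 + 1), ((k + 1).choose i : ℂ) * fconv (F i t) (G (k + 1 - i) t) ξ = _
    have h := Finset.sum_choose_succ_mul (fun a b => fconv (F a t) (G b t) ξ) k
    rw [show k + 1 + 1 = k + 2 from rfl, h, add_comm, ← Finset.sum_add_distrib]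
    refine Finset.sum_congr rfl fun i hi => ?_
    have hi' : i ≤ k := Nat.lt_succ_iff.1 (Finset.mem_range.1 hi)
    rw [Nat.sub_add_comm hi', mul_add]

/-! #### The nonlinearity and the pressure symbol of two vector families -/

variable [DecidableEq ι]

/-- The family of the projected nonlinearity of two vector families `V`, `W` (indexed
componentwise): `N_k(t)(ξ)_l = -2πi ∑_{j,k'} m_{jk'l}(ξ) L^{(j,k')}_k(t)(ξ)`, `L^{(j,k')}` the
Leibniz family of the scalar families `V_j`, `W_{k'}`. [folklore] -/
def nonlinFamily (V W : ℕ → ℝ → EuclideanSpace ℝ ι → ι → ℂ) (k : ℕ) (t : ℝ)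
    (ξ : EuclideanSpace ℝ ι) (l : ι) : ℂ :=
  -(2 * π * Complex.I) * ∑ j, ∑ k', (lerayDerivSymbol j k' l ξ : ℂ) *
    leibnizFamily (fun i s η => V i s η j) (fun i s η => W i s η k') k t ξ

/-- `N₀ = N(V₀, W₀)`. [folklore] -/
theorem nonlinFamily_zero (V W : ℕ → ℝ → EuclideanSpace ℝ ι → ι → ℂ) (t : ℝ)
    (ξ : EuclideanSpace ℝ ι) : nonlinFamily V W 0 t ξ = nonlin (V 0 t) (W 0 t) ξ := by
  ext l
  simp [nonlinFamily, nonlin_apply]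

/-- **The nonlinearity of two vector families is a family** (componentwise). [folklore] -/
theorem IsFourierFamily.nonlinFamily (hT : 0 < T) {V W : ℕ → ℝ → EuclideanSpace ℝ ι → ι → ℂ}
    (hV : ∀ j, IsFourierFamily T n (fun k t ξ => V k t ξ j))
    (hW : ∀ j, IsFourierFamily T n (fun k t ξ => W k t ξ j)) (l : ι) :
    IsFourierFamily T n (fun k t ξ => nonlinFamily V W k t ξ l) := by
  unfold FourierNS.nonlinFamily
  refine IsFourierFamily.const_mul ?_ _
  refine IsFourierFamily.finset_sum _ fun j _ => IsFourierFamily.finset_sum _ fun k' _ => ?_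
  refine ((hV j).leibniz hT (hW k')).symbol
    ((continuous_lerayDerivSymbol j k' l).measurable.complex_ofReal.aestronglyMeasurable)
    (d := 1) (M := 2) (by norm_num) fun ξ => ?_
  calc ‖(lerayDerivSymbol j k' l ξ : ℂ)‖ ≤ 2 * ‖ξ‖ := norm_ofReal_lerayDerivSymbol_le j k' l ξ
    _ ≤ 2 * (1 + ‖ξ‖) ^ 1 := by rw [pow_one]; linarith [norm_nonneg ξ]

/-- The family of the pressure symbol of two vector families:
`q_k(t)(ξ) = -∑_{j,k'} (ξⱼξ_{k'}/‖ξ‖²) L^{(j,k')}_k(t)(ξ)`. [folklore] -/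
def presFamily (V W : ℕ → ℝ → EuclideanSpace ℝ ι → ι → ℂ) (k : ℕ) (t : ℝ)
    (ξ : EuclideanSpace ℝ ι) : ℂ :=
  -∑ j, ∑ k', ((ξ j * ξ k' / ‖ξ‖ ^ 2 : ℝ) : ℂ) *
    leibnizFamily (fun i s η => V i s η j) (fun i s η => W i s η k') k t ξ

omit [DecidableEq ι] in
/-- `q₀ = q(V₀, W₀)`. [folklore] -/
theorem presFamily_zero (V W : ℕ → ℝ → EuclideanSpace ℝ ι → ι → ℂ) (t : ℝ)
    (ξ : EuclideanSpace ℝ ι) : presFamily V W 0 t ξ = presSymbol (V 0 t) (W 0 t) ξ := by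
  simp [presFamily, presSymbol]

omit [DecidableEq ι] in
/-- The pressure multiplier `ξⱼξₖ/‖ξ‖²` is measurable (a quotient of continuous functions). [folklore] -/
theorem measurable_presMultiplier (j k : ι) :
    Measurable fun ξ : EuclideanSpace ℝ ι => ξ j * ξ k / ‖ξ‖ ^ 2 := by
  have hc : ∀ i : ι, Measurable fun ξ : EuclideanSpace ℝ ι => ξ i := fun i =>
    (EuclideanSpace.proj i).continuous.measurable
  exact ((hc j).mul (hc k)).div (continuous_norm.measurable.pow_const 2)

omit [DecidableEq ι] in
/-- **The pressure symbol of two vector families is a family.** [folklore] -/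
theorem IsFourierFamily.presFamily (hT : 0 < T) {V W : ℕ → ℝ → EuclideanSpace ℝ ι → ι → ℂ}
    (hV : ∀ j, IsFourierFamily T n (fun k t ξ => V k t ξ j))
    (hW : ∀ j, IsFourierFamily T n (fun k t ξ => W k t ξ j)) :
    IsFourierFamily T n (presFamily V W) := by
  unfold FourierNS.presFamily
  refine IsFourierFamily.neg ?_
  refine IsFourierFamily.finset_sum _ fun j _ => IsFourierFamily.finset_sum _ fun k' _ => ?_
  refine ((hV j).leibniz hT (hW k')).symbol
    ((measurable_presMultiplier j k').complex_ofReal.aestronglyMeasurable)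
    (d := 0) (M := 1) zero_le_one fun ξ => ?_
  rw [pow_zero, mul_one, Complex.norm_real, Real.norm_eq_abs]
  exact abs_mul_div_norm_sq_le_one j k' ξ

end Family

end Literature.Analysis.FluidPDE.FourierNS

end
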